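import Literature.Probability.Percolation.IntPairUp
import HarnessLib

/-!
# The cross-frame inner pair step: routes avoiding a foreign set (twin of `TrapPairAvoid.lean`)

Topic `Literature/Probability/Percolation`; family `crit-perc` / near-critical percolation on `𝕋`.
A brick of the INNER half of the near-critical arm-separation theorem for four arms in the ADJACENT
colour arrangement (P. Nolin, EJP 13 (2008), Thm. 11, `j = 4`, `σ = BBWW` [arXiv 0711.4948:
Thm. 10], §4.4 Lemma 15, internal extremities). Word-for-word twin of `TrapPairAvoid.lean`:
`route_c_in`, `route_d_in`, `term_avoid`, `termUp_avoid`, `route_c_avoid`, `route_d_avoid`.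

Everything here is proved; no named facts are introduced.

## References

* P. Nolin, Near-critical percolation in two dimensions, *Electron. J. Probab.* 13 (2008), §4.4,
  proof of Lemma 15, internal extremities (arXiv 0711.4948: Lemma 14) [Nolin2008].
* H. Kesten, *Percolation theory for mathematicians* (1982), §2.3 Prop. 2.3 [KestenPTM1982].
-/

noncomputable section

open Set

namespace Literature.Probability.Percolation

open LatticeModels HalfAnnulus Literature.Combinatorics.SimpleGraph

open IntPairData (term_isCrossing)


namespace IntPairDataB

variable {m N k₀ K T T' R₀ : ℕ} {ω : SiteConfig (Site 2)}

/-! ### The canonical routes with explicit sites -/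

/-- **The canonical route through the minimal term from below lies in `arms ∪ c ∪ F_c`.** [cite: Nolin2008, §4.4 Lemma 15 (proof) (arXiv 0711.4948: Lemma 14)] -/
theorem route_c_in (D : IntPairDataB m N k₀ K T T' R₀ ω) {c : Finset (Site 2)} {z : Site 2}
    (hu : (intDom m).lowestSeq ω D.uMin = some (c, z)) :
    ∃ i, PathIn triGraph (D.armSet ∪ (↑c : Set (Site 2)) ∪ (D.fence hu).F) (D.b i) (D.fence hu).m' := by
  classical
  set Tf := D.fence hu
  have hF : Tf.F ⊆ D.armSet ∪ (↑c : Set (Site 2)) ∪ Tf.F := Set.subset_union_right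
  have hqm : Tf.q ∈ D.armSet ∪ (↑c : Set (Site 2)) ∪ Tf.F →
      PathIn triGraph (D.armSet ∪ (↑c : Set (Site 2)) ∪ Tf.F) Tf.q Tf.m' :=
    fun hq => (PathIn.of_adj hq (hF Tf.path.left_mem) Tf.adj).trans (Tf.path.mono hF)
  rcases Tf.q_mem with hq | ⟨i', hq⟩
  · obtain ⟨x, hx⟩ := D.αF_meet hu
    rw [Finset.mem_inter] at hx
    have hxA : x ∈ (D.A 0).support := D.αF_subset x hx.1
    have h1 : PathIn triGraph (D.armSet ∪ (↑c : Set (Site 2)) ∪ Tf.F) (D.b 0) x :=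
      PathIn.of_walk ((D.A 0).takeUntil x hxA) fun v hv =>
        Or.inl (Or.inl (D.mem_armSet ((D.A 0).support_takeUntil_subset_support hxA hv)))
    have h2 : PathIn triGraph (D.armSet ∪ (↑c : Set (Site 2)) ∪ Tf.F) x Tf.q :=
      ((term_isCrossing hu).conn x hx.2 Tf.q (Finset.mem_coe.1 hq)).mono fun v hv => Or.inl (Or.inr hv)
    exact ⟨0, (h1.trans h2).trans (hqm (Or.inl (Or.inr hq)))⟩
  · exact ⟨i', (PathIn.of_walk ((D.A i').takeUntil Tf.q hq) fun v hv =>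
      Or.inl (Or.inl (D.mem_armSet ((D.A i').support_takeUntil_subset_support hq hv)))).trans
        (hqm (Or.inl (Or.inl ⟨i', hq⟩)))⟩

/-- **The canonical route through the minimal term from above lies in `arms ∪ d ∪ F_d`.** [cite: Nolin2008, §4.4 Lemma 15 (proof) (arXiv 0711.4948: Lemma 14)] -/
theorem route_d_in (D : IntPairDataB m N k₀ K T T' R₀ ω) {d : Finset (Site 2)} {z : Site 2}
    (hu : (intDom m).flip.lowestSeq ω D.uMinUp = some (d, z)) :
    ∃ i, PathIn triGraph (D.armSet ∪ (↑d : Set (Site 2)) ∪ (D.fenceUp hu).F) (D.b i) (D.fenceUp hu).m' := by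
  classical
  set Tf := D.fenceUp hu
  have hF : Tf.F ⊆ D.armSet ∪ (↑d : Set (Site 2)) ∪ Tf.F := Set.subset_union_right
  have hqm : Tf.q ∈ D.armSet ∪ (↑d : Set (Site 2)) ∪ Tf.F →
      PathIn triGraph (D.armSet ∪ (↑d : Set (Site 2)) ∪ Tf.F) Tf.q Tf.m' :=
    fun hq => (PathIn.of_adj hq (hF Tf.path.left_mem) Tf.adj).trans (Tf.path.mono hF)
  rcases Tf.q_mem with hq | ⟨i', hq⟩
  · obtain ⟨x, hx⟩ := D.αF_meetUp hu
    rw [Finset.mem_inter] at hx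
    have hxA : x ∈ (D.A 0).support := D.αF_subset x hx.1
    have h1 : PathIn triGraph (D.armSet ∪ (↑d : Set (Site 2)) ∪ Tf.F) (D.b 0) x :=
      PathIn.of_walk ((D.A 0).takeUntil x hxA) fun v hv =>
        Or.inl (Or.inl (D.mem_armSet ((D.A 0).support_takeUntil_subset_support hxA hv)))
    have h2 : PathIn triGraph (D.armSet ∪ (↑d : Set (Site 2)) ∪ Tf.F) x Tf.q :=
      ((termUp_isCrossing hu).conn x hx.2 Tf.q (Finset.mem_coe.1 hq)).mono fun v hv => Or.inl (Or.inr hv)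
    exact ⟨0, (h1.trans h2).trans (hqm (Or.inl (Or.inr hq)))⟩
  · exact ⟨i', (PathIn.of_walk ((D.A i').takeUntil Tf.q hq) fun v hv =>
      Or.inl (Or.inl (D.mem_armSet ((D.A i').support_takeUntil_subset_support hq hv)))).trans
        (hqm (Or.inl (Or.inl ⟨i', hq⟩)))⟩

/-! ### Foreign sets missing the minimal terms -/

/-- **A foreign set hanging from the top side misses the minimal term from below.** If `X` avoids
the arms and every site of `X` in the half-annulus is joined inside `X ∩ haFin m` to a top-type site, then `X` misses the minimal term `c` of the arm `0`: such sites are above the final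
crossing `α` (they are joined off `α` to `Tp`), while `c ⊆ lower α`. [cite: KestenPTM1982, §2.3 Prop. 2.3] -/
theorem term_avoid (D : IntPairDataB m N k₀ K T T' R₀ ω) {c : Finset (Site 2)} {z : Site 2}
    (hu : (intDom m).lowestSeq ω D.uMin = some (c, z)) {X : Set (Site 2)} (hXarm : ∀ x ∈ X, x ∉ D.armSet)
    (hX : ∀ x ∈ X, x ∈ haFin m → ∃ x' ∈ (intDom m).Tp, PathIn triGraph (X ∩ ↑(haFin m)) x x') :
    ∀ x ∈ X, x ∉ c := by
  intro x hxX hxc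
  have hxD : x ∈ haFin m := (term_isCrossing hu).subset hxc
  obtain ⟨x', hx'U, hp⟩ := hX x hxX hxD
  have hαA : ∀ v ∈ D.αF, v ∈ D.armSet := fun v hv => D.mem_armSet (D.αF_subset v hv)
  have hp' : PathIn triGraph (↑((intDom m).D \ D.αF) : Set (Site 2)) x x' :=
    hp.mono fun v hv => by
      rw [Finset.coe_sdiff]
      exact ⟨hv.2, fun h => hXarm v hv.1 (hαA v h)⟩
  have hx'α : x' ∉ D.αF := fun h => hXarm x' hp.right_mem.1 (hαA x' h)
  have hx'a : x' ∈ (intDom m).above D.αF (D.y 0) := D.αF_isCrossing.mem_above_of_mem_Tp hx'U hx'α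
  have hxa := JDomain.mem_above_of_pathIn hx'a hp'
  exact (JDomain.mem_lower_iff_not_mem_above (show x ∈ (intDom m).D from hxD)).1 (D.cMin_subset_lower hu hxc) hxa

/-- **A foreign set hanging from the bottom side misses the minimal term from above** (the same
in the flipped domain: `d ⊆ flip.lower α`, sites joined off `α` to `Bt = flip.Tp` are `flip`-above). [cite: KestenPTM1982, §2.3 Prop. 2.3] -/
theorem termUp_avoid (D : IntPairDataB m N k₀ K T T' R₀ ω) {d : Finset (Site 2)} {z : Site 2}
    (hu : (intDom m).flip.lowestSeq ω D.uMinUp = some (d, z)) {X : Set (Site 2)} (hXarm : ∀ x ∈ X, x ∉ D.armSet)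
    (hX : ∀ x ∈ X, x ∈ haFin m → ∃ x' ∈ (intDom m).Bt, PathIn triGraph (X ∩ ↑(haFin m)) x x') :
    ∀ x ∈ X, x ∉ d := by
  intro x hxX hxd
  have hxD : x ∈ haFin m := (termUp_isCrossing hu).subset hxd
  obtain ⟨x', hx'B, hp⟩ := hX x hxX hxD
  have hαA : ∀ v ∈ D.αF, v ∈ D.armSet := fun v hv => D.mem_armSet (D.αF_subset v hv)
  have hp' : PathIn triGraph (↑((intDom m).flip.D \ D.αF) : Set (Site 2)) x x' :=
    hp.mono fun v hv => by
      rw [Finset.coe_sdiff]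
      exact ⟨hv.2, fun h => hXarm v hv.1 (hαA v h)⟩
  have hx'α : x' ∉ D.αF := fun h => hXarm x' hp.right_mem.1 (hαA x' h)
  have hx'a : x' ∈ (intDom m).flip.above D.αF (D.y 0) :=
    D.αF_isCrossingUp.mem_above_of_mem_Tp hx'B hx'α
  have hxa := JDomain.mem_above_of_pathIn hx'a hp'
  exact (JDomain.mem_lower_iff_not_mem_above (show x ∈ (intDom m).flip.D from hxD)).1
    (D.dMin_subset_flip_lower hu hxd) hxa

/-! ### The packaged routes -/

/-- **Admissible route to the fence of the minimal term from below, off a foreign set hanging from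
the top side** (and off the arms and that fence). [cite: Nolin2008, §4.4 Lemma 15 (proof) (arXiv 0711.4948: Lemma 14)] -/
theorem route_c_avoid (D : IntPairDataB m N k₀ K T T' R₀ ω) {c : Finset (Site 2)} {z : Site 2}
    (hu : (intDom m).lowestSeq ω D.uMin = some (c, z)) {X : Set (Site 2)} (hXarm : ∀ x ∈ X, x ∉ D.armSet)
    (hX : ∀ x ∈ X, x ∈ haFin m → ∃ x' ∈ (intDom m).Tp, PathIn triGraph (X ∩ ↑(haFin m)) x x')
    (hXF : ∀ x ∈ X, x ∉ (D.fence hu).F) :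
    ∃ (i : Fin 2) (S : Set (Site 2)), PathIn triGraph S (D.b i) (D.fence hu).m' ∧ S ⊆ D.AsetB ∧
      (D.fence hu).m' ∈ (D.fence hu).F ∧ Disjoint S X := by
  obtain ⟨i, hP⟩ := D.route_c_in hu
  refine ⟨i, _, hP, ?_, (D.fence hu).m'_mem, ?_⟩
  · rintro v ((hv | hv) | hv)
    · exact D.Aset_subset_AsetB (D.armSet_subset_Aset hv)
    · exact D.Aset_subset_AsetB (D.term_subset_Aset hu hv)
    · exact D.Aset_subset_AsetB (D.fence_subset_Aset hu hv)
  · rw [Set.disjoint_left]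
    rintro v ((hv | hv) | hv) hvX
    · exact hXarm v hvX hv
    · exact D.term_avoid hu hXarm hX v hvX hv
    · exact hXF v hvX hv

/-- **Admissible route to the fence of the minimal term from above, off a foreign set hanging from
the bottom side** (and off the arms and that fence). [cite: Nolin2008, §4.4 Lemma 15 (proof) (arXiv 0711.4948: Lemma 14)] -/
theorem route_d_avoid (D : IntPairDataB m N k₀ K T T' R₀ ω) {d : Finset (Site 2)} {z : Site 2}
    (hu : (intDom m).flip.lowestSeq ω D.uMinUp = some (d, z)) {X : Set (Site 2)} (hXarm : ∀ x ∈ X, x ∉ D.armSet)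
    (hX : ∀ x ∈ X, x ∈ haFin m → ∃ x' ∈ (intDom m).Bt, PathIn triGraph (X ∩ ↑(haFin m)) x x')
    (hXF : ∀ x ∈ X, x ∉ (D.fenceUp hu).F) :
    ∃ (i : Fin 2) (S : Set (Site 2)), PathIn triGraph S (D.b i) (D.fenceUp hu).m' ∧ S ⊆ D.AsetB ∧
      (D.fenceUp hu).m' ∈ (D.fenceUp hu).F ∧ Disjoint S X := by
  obtain ⟨i, hP⟩ := D.route_d_in hu
  refine ⟨i, _, hP, ?_, (D.fenceUp hu).path.right_mem, ?_⟩
  · rintro v ((hv | hv) | hv)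
    · exact D.Aset_subset_AsetB (D.armSet_subset_Aset hv)
    · exact D.termUp_subset_AsetB hu hv
    · exact D.fenceUp_subset_AsetB hu hv
  · rw [Set.disjoint_left]
    rintro v ((hv | hv) | hv) hvX
    · exact hXarm v hvX hv
    · exact D.termUp_avoid hu hXarm hX v hvX hv
    · exact hXF v hvX hv

end IntPairDataB

end Literature.Probability.Percolation
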